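import Mathlib
import Literature.NumberTheory.Transcendental.LandauDefectLatticeTate
import Literature.NumberTheory.Transcendental.AxSchanuelProofs
import Summits.KontsevichZagierPeriods.KontsevichZagierPeriods.Theorems.InverseLandauInverseLandauRationalCurvesKernel

/-!
# Crux `InverseLandauRationalCurves`, line `Sketch` — kernel, VII: lattice bookkeeping

Helpers for the lead's stub `stub_kernel` (item stmt-KontsevichZagierPeriods-13872): exact
relations have zero logarithmic derivative; spans of lattice vectors under extension of scalars;
unpacking a span membership into the crux's `Σ_q c_q n_q` format; poles of a Tate family are
`≠ 0, 1` and are roots of `Q_{K′}`.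
-/

noncomputable section

open Polynomial
open Literature.NumberTheory.Transcendental Literature.NumberTheory.Transcendental.AyoubRel

namespace Summit.KontsevichZagierPeriods.InverseLandau.RationalCurves

section Lattice

variable {k₁ K : Type*} [Field k₁] [Field K] [Algebra k₁ K] {ι : Type*} [Fintype ι]

/-- **Exact relations are horizontal**: if `w` lies in the `k₁`-span of the exact relation
lattice of the Landau datum `g`, then `Σᵢ wᵢ · Dgᵢ/gᵢ = 0` (the logarithmic derivative of
`∏ gᵢ^{nᵢ} = 1` vanishes). -/
theorem sum_dlog_eq_zero_of_mem_span {R : Type*} [CommRing R] [Algebra R K] (D : Derivation R K K)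
    (g : ι → Kˣ) {w : ι → k₁}
    (hw : w ∈ Submodule.span k₁ ((fun n : ι → ℤ => fun i => ((n i : ℤ) : k₁)) ''
      (Landau.relationLattice g : Set (ι → ℤ)))) :
    ∑ i, algebraMap k₁ K (w i) * ((g i : K)⁻¹ * D (g i)) = 0 := by
  induction hw using Submodule.span_induction with
  | mem x hx =>
    obtain ⟨n, hn, rfl⟩ := hx
    have hrel : Landau.monomial g n = 1 := Landau.mem_relationLattice.1 hn
    have key := inv_mul_derivation_prod_zpow D Finset.univ (fun i => (g i : K))
      (fun i _ => (g i).ne_zero) n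
    rw [← Landau.val_monomial, hrel, Units.val_one, Derivation.map_one_eq_zero, mul_zero] at key
    rw [key]
    refine Finset.sum_congr rfl fun i _ => ?_
    simp only [map_intCast]
  | zero => simp
  | add x y _ _ hx hy =>
    simp only [Pi.add_apply, map_add, add_mul, Finset.sum_add_distrib, hx, hy, add_zero]
  | smul c x _ hx =>
    have e : ∀ i ∈ (Finset.univ : Finset ι),
        algebraMap k₁ K ((c • x) i) * ((g i : K)⁻¹ * D (g i)) =
          algebraMap k₁ K c * (algebraMap k₁ K (x i) * ((g i : K)⁻¹ * D (g i))) := fun i _ => by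
      simp only [Pi.smul_apply, smul_eq_mul, map_mul, mul_assoc]
    rw [Finset.sum_congr rfl e, ← Finset.mul_sum, hx, mul_zero]

omit [Fintype ι] in
/-- **Extension of scalars for lattice spans**: the image under `k₁ → K` of a vector in the
`k₁`-span of (the image of) a set of integer vectors lies in its `K`-span. -/
theorem map_mem_span_image {Λ : Set (ι → ℤ)} {w : ι → k₁}
    (hw : w ∈ Submodule.span k₁ ((fun n : ι → ℤ => fun i => ((n i : ℤ) : k₁)) '' Λ)) :
    (fun i => algebraMap k₁ K (w i)) ∈
      Submodule.span K ((fun n : ι → ℤ => fun i => ((n i : ℤ) : K)) '' Λ) := by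
  induction hw using Submodule.span_induction with
  | mem x hx =>
    obtain ⟨n, hn, rfl⟩ := hx
    refine Submodule.subset_span ⟨n, hn, ?_⟩
    funext i
    simp only [map_intCast]
  | zero =>
    have : (fun i : ι => algebraMap k₁ K ((0 : ι → k₁) i)) = 0 := by
      funext i; simp only [Pi.zero_apply, map_zero]
    rw [this]; exact Submodule.zero_mem _
  | add x y _ _ hx hy =>
    have : (fun i : ι => algebraMap k₁ K ((x + y) i)) =
        (fun i => algebraMap k₁ K (x i)) + fun i => algebraMap k₁ K (y i) := by
      funext i; simp only [Pi.add_apply, map_add]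
    rw [this]; exact Submodule.add_mem _ hx hy
  | smul c x _ hx =>
    have : (fun i : ι => algebraMap k₁ K ((c • x) i)) =
        algebraMap k₁ K c • fun i => algebraMap k₁ K (x i) := by
      funext i; simp only [Pi.smul_apply, smul_eq_mul, map_mul]
    rw [this]; exact Submodule.smul_mem _ _ hx

omit [Fintype ι] in
/-- **Unpacking a span membership** into a finite integer combination
`a = Σ_q c_q · n_q` with every `n_q` in the given set of lattice vectors. -/
theorem exists_fin_combination_of_mem_span {Λ : Set (ι → ℤ)} {a : ι → K}
    (ha : a ∈ Submodule.span K ((fun n : ι → ℤ => fun i => ((n i : ℤ) : K)) '' Λ)) :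
    ∃ (s : ℕ) (c : Fin s → K) (nv : Fin s → (ι → ℤ)), (∀ q, nv q ∈ Λ) ∧
      a = ∑ q, c q • fun i => ((nv q i : ℤ) : K) := by
  obtain ⟨s, f, g, hsum⟩ := Submodule.mem_span_set'.1 ha
  choose nv hnv heq using fun q => (g q).2
  refine ⟨s, f, nv, hnv, ?_⟩
  rw [← hsum]
  refine Finset.sum_congr rfl fun q _ => ?_
  rw [← heq q]

end Lattice

section Poles

variable {k : Type*} [Field k] (T : TateFamily₁ k) {K' : Type*} [Field K'] [Algebra (RatFunc k) K']

/-- Pole branches are roots of `Q_{K′}`. -/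
theorem isRoot_QK_of_mem_landauSet {p : K'} (hp : p ∈ landauSet K' T.toRatFunc) :
    ((TateFamily₁.toParamPoly T.Q).map (algebraMap (RatFunc k) K')).IsRoot p := by
  rw [IsRoot.def, eval_map, ← aeval_def]
  exact T.aeval_toParamPoly_Q_eq_zero hp

/-- Pole branches are `≠ 0`. -/
theorem ne_zero_of_mem_landauSet {p : K'} (hp : p ∈ landauSet K' T.toRatFunc) : p ≠ 0 := by
  intro h
  have := isRoot_QK_of_mem_landauSet T hp
  rw [h, IsRoot.def] at this
  exact eval_zero_QK_ne_zero T this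

/-- Pole branches are `≠ 1`. -/
theorem ne_one_of_mem_landauSet {p : K'} (hp : p ∈ landauSet K' T.toRatFunc) : p ≠ 1 := by
  intro h
  have := isRoot_QK_of_mem_landauSet T hp
  rw [h, IsRoot.def] at this
  exact eval_one_QK_ne_zero T this

/-- The Landau function of a pole branch is `(p - 1)/p`. -/
theorem val_landauDatum (p : landauSet K' T.toRatFunc) :
    (landauDatum K' T.toRatFunc p : K') = ((p : K') - 1) / p :=
  val_landauUnit K' (ne_zero_of_mem_landauSet T p.2) (ne_one_of_mem_landauSet T p.2)

end Poles

/-- **Registered sub-goal `kernel_final_pack`** (packaging for the gate): the Landau function of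
a pole branch of a Tate family is `(p - 1)/p` (poles are `≠ 0, 1`). -/
theorem kernel_final_pack : ∀ {k : Type*} [Field k] (T : TateFamily₁ k) {K' : Type*} [Field K']
    [Algebra (RatFunc k) K'] (p : landauSet K' T.toRatFunc),
    (landauDatum K' T.toRatFunc p : K') = ((p : K') - 1) / p :=
  fun T _ _ _ p => val_landauDatum T p

end Summit.KontsevichZagierPeriods.InverseLandau.RationalCurves

end
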